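import Mathlib.Topology.Homotopy.Equiv
import Mathlib.Analysis.Normed.Module.Basic
import Mathlib.Topology.Compactness.Compact
import Mathlib.Algebra.Order.Floor.Defs
import HarnessLib

/-!
# The mapping telescope of a self-map of a compact subset of a normed space, concretely

Topic `Literature/AlgebraicTopology/Homotopy` (sub-namespace `Telescope`). Hatcher, *Algebraic
Topology* (2002), §3.F (p. 312) and proof of Prop. A.11 (p. 528): the mapping telescope
`T(f, f, …)` of a sequence `X →ᶠ X →ᶠ X → ⋯` is the quotient of `∐ₖ X × [k, k + 1]` by
`(x, k + 1)ₖ ∼ (f x, k + 1)ₖ₊₁`. For a self-map `f` of a subset `P` of a real normed space `E`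
we realise this space *concretely* as a subset of `E × E × ℝ`,

  `Telescope.emb f k x s = ((1 - s) • x + s • f x, (s * (1 - s)) • x, k + s)`, `x ∈ P`,
  `s ∈ [0, 1]`,

which identifies exactly the pairs the quotient identifies (`emb f k x 1 = emb f (k + 1) (f x) 0`,
and `emb` is injective for `s ∈ [0, 1)`), so that Hausdorffness is free and maps *into* the
telescope are just maps into `E × E × ℝ`. Maps *out of* it are handled by the universal property
of the quotient, recovered here for compact `P`: a function on the telescope is continuous as
soon as its pullbacks `(x, s) ↦ F (emb f k x s)` are continuous on `P × [0, 1]` for every `k`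
(`Telescope.continuousOn_of_comp_emb`; each piece is a continuous image of the compact
`P × [0, 1]`, hence a quotient of it, and the pieces form a locally finite closed cover).

* `Telescope.emb`, `Telescope.piece`, `Telescope.space f P = ⋃ₖ piece f P k`;
* `Telescope.lift F`: the function on `E × E × ℝ` which is `F k x s` at `emb f k x s`
  (`Telescope.lift_emb`, needs the compatibility `F k x 1 = F (k + 1) (f x) 0` on `P`);
* `Telescope.continuousOn_lift`, `Telescope.continuousOn_of_comp_emb`: continuity criteria;
* `Telescope.isClosed_space`, local finiteness of the pieces.

This is infrastructure for the proof that a compact Euclidean neighbourhood retract has the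
homotopy type of a CW complex (Hatcher Prop. A.11 / Cor. A.12) in the sibling files. No `sorry`;
[folklore] throughout (the construction is Hatcher's telescope, the embedding in `E × E × ℝ` is
ours and purely technical).

## References

* A. Hatcher, *Algebraic Topology*, CUP (2002), §3.F p. 312 (mapping telescope), Appendix,
  proof of Prop. A.11 (p. 528). [HatcherAT2002]
-/

noncomputable section

open Set Function Topology Filter

namespace Literature.AlgebraicTopology.Homotopy

/-! ### A continuity criterion on continuous images of compact sets -/

/-- **Maps out of a compact quotient**: if `φ` is continuous on a compact set `S` with values in
a Hausdorff space, a function `ψ` on the image `φ '' S` is continuous as soon as `ψ ∘ φ` is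
continuous on `S` (the corestriction `S → φ '' S` is a closed, hence quotient, map). [folklore] -/
theorem continuousOn_image_of_comp {A B Z : Type*} [TopologicalSpace A] [TopologicalSpace B]
    [T2Space B] [TopologicalSpace Z] {S : Set A} (hS : IsCompact S) {φ : A → B}
    (hφ : ContinuousOn φ S) {ψ : B → Z} (hψ : ContinuousOn (ψ ∘ φ) S) :
    ContinuousOn ψ (φ '' S) := by
  haveI : CompactSpace S := isCompact_iff_compactSpace.1 hS
  let φ' : S → φ '' S := fun a => ⟨φ a, mem_image_of_mem φ a.2⟩
  have hφ' : Continuous φ' := hφ.restrict.subtype_mk _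
  have hsurj : Surjective φ' := by
    rintro ⟨b, a, ha, rfl⟩
    exact ⟨⟨a, ha⟩, rfl⟩
  have hq : IsQuotientMap φ' := IsQuotientMap.of_surjective_continuous hsurj hφ'
  rw [continuousOn_iff_continuous_restrict, hq.continuous_iff]
  exact hψ.restrict

namespace Telescope

variable {E : Type*} [NormedAddCommGroup E] [NormedSpace ℝ E]

/-! ### The embedding of the `k`-th cylinder -/

/-- The point of the concrete telescope at level `k`, base point `x` and height `s ∈ [0, 1]`:
`((1 - s) x + s f x, s (1 - s) x, k + s) ∈ E × E × ℝ`. [folklore] -/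
def emb (f : E → E) (k : ℕ) (x : E) (s : ℝ) : E × E × ℝ :=
  ((1 - s) • x + s • f x, (s * (1 - s)) • x, (k : ℝ) + s)

/-- The third coordinate of `emb f k x s` is `k + s`. [folklore] -/
@[simp]
theorem emb_height (f : E → E) (k : ℕ) (x : E) (s : ℝ) : (emb f k x s).2.2 = k + s := rfl

/-- At height `0` the telescope point is `(x, 0, k)`. [folklore] -/
@[simp]
theorem emb_zero (f : E → E) (k : ℕ) (x : E) : emb f k x 0 = (x, 0, (k : ℝ)) := by
  simp [emb]

/-- **The telescope identification**: the top of the `k`-th cylinder over `x` is the bottom of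
the `(k + 1)`-st cylinder over `f x`. [folklore] -/
theorem emb_one (f : E → E) (k : ℕ) (x : E) : emb f k x 1 = emb f (k + 1) (f x) 0 := by
  simp [emb]

/-- `emb f k` is jointly continuous in `(x, s)` on `P × ℝ` when `f` is continuous on `P`.
[folklore] -/
theorem continuousOn_emb {f : E → E} {P : Set E} (hf : ContinuousOn f P) (k : ℕ) :
    ContinuousOn (fun p : E × ℝ => emb f k p.1 p.2) (P ×ˢ univ) := by
  have h1 : ContinuousOn (fun p : E × ℝ => f p.1) (P ×ˢ univ) :=
    hf.comp continuous_fst.continuousOn fun p hp => hp.1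
  unfold emb
  refine ContinuousOn.prodMk ?_ (ContinuousOn.prodMk ?_ ?_)
  · exact ((continuous_const.sub continuous_snd).continuousOn.smul continuous_fst.continuousOn).add
      (continuous_snd.continuousOn.smul h1)
  · exact ((continuous_snd.mul (continuous_const.sub continuous_snd)).smul
      continuous_fst).continuousOn
  · exact (continuous_const.add continuous_snd).continuousOn

/-- **Injectivity below the top**: for heights in `[0, 1)` the level, the base point and the
height are determined by the telescope point. [folklore] -/
theorem emb_injective {f : E → E} {k k' : ℕ} {x x' : E} {s s' : ℝ} (hs : s ∈ Ico (0 : ℝ) 1)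
    (hs' : s' ∈ Ico (0 : ℝ) 1) (h : emb f k x s = emb f k' x' s') :
    k = k' ∧ x = x' ∧ s = s' := by
  have h3 : (k : ℝ) + s = k' + s' := congrArg (fun p => p.2.2) h
  have hk : k = k' := by
    have h4 : (k : ℝ) < k' + 1 := by linarith [hs.1, hs'.2]
    have h5 : (k' : ℝ) < k + 1 := by linarith [hs'.1, hs.2]
    have h4' : k < k' + 1 := by exact_mod_cast h4
    have h5' : k' < k + 1 := by exact_mod_cast h5
    omega
  subst hk
  have hss : s = s' := by linarith
  subst hss
  refine ⟨rfl, ?_, rfl⟩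
  rcases hs.1.eq_or_lt with h0 | h0
  · subst h0
    simpa [emb] using congrArg Prod.fst h
  · have h2 : (s * (1 - s)) • x = (s * (1 - s)) • x' := congrArg (fun p => p.2.1) h
    have hne : s * (1 - s) ≠ 0 := mul_ne_zero h0.ne' (by linarith [hs.2])
    exact smul_right_injective E hne h2

/-! ### The pieces and the telescope -/

/-- The `k`-th piece of the telescope: the image of `P × [0, 1]` under `emb f k`. [folklore] -/
def piece (f : E → E) (P : Set E) (k : ℕ) : Set (E × E × ℝ) :=
  (fun p : E × ℝ => emb f k p.1 p.2) '' (P ×ˢ Icc 0 1)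

/-- **The mapping telescope** of `f : P → P` as a subset of `E × E × ℝ`: the union of its pieces.
(Hatcher 2002, §3.F: the quotient of `∐ₖ X × [k, k + 1]` by `(x, k + 1) ∼ (f x, k + 1)`; here
realised injectively.) [cite: HatcherAT2002, §3.F (mapping telescope, p. 312)] -/
def space (f : E → E) (P : Set E) : Set (E × E × ℝ) := ⋃ k : ℕ, piece f P k

/-- Telescope points of the `k`-th piece. [folklore] -/
theorem emb_mem_piece {f : E → E} {P : Set E} (k : ℕ) {x : E} (hx : x ∈ P) {s : ℝ}
    (hs : s ∈ Icc (0 : ℝ) 1) : emb f k x s ∈ piece f P k :=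
  ⟨(x, s), ⟨hx, hs⟩, rfl⟩

/-- Telescope points. [folklore] -/
theorem emb_mem_space {f : E → E} {P : Set E} (k : ℕ) {x : E} (hx : x ∈ P) {s : ℝ}
    (hs : s ∈ Icc (0 : ℝ) 1) : emb f k x s ∈ space f P :=
  mem_iUnion.2 ⟨k, emb_mem_piece k hx hs⟩

/-- Pieces lie in the telescope. [folklore] -/
theorem piece_subset_space (f : E → E) (P : Set E) (k : ℕ) : piece f P k ⊆ space f P :=
  subset_iUnion _ k

/-- Heights on the `k`-th piece lie in `[k, k + 1]`. [folklore] -/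
theorem height_mem_of_mem_piece {f : E → E} {P : Set E} {k : ℕ} {p : E × E × ℝ}
    (hp : p ∈ piece f P k) : p.2.2 ∈ Icc (k : ℝ) (k + 1) := by
  obtain ⟨⟨x, s⟩, ⟨-, hs⟩, rfl⟩ := hp
  simp only [emb_height]
  exact ⟨by linarith [hs.1], by linarith [hs.2]⟩

/-- **Canonical representatives**: every telescope point is `emb f k x s` with `x ∈ P` and
`s ∈ [0, 1)` (a top point `emb f k x 1` is the bottom point `emb f (k + 1) (f x) 0`), provided
`f` maps `P` into itself. [folklore] -/
theorem exists_rep {f : E → E} {P : Set E} (hfP : MapsTo f P P) {p : E × E × ℝ}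
    (hp : p ∈ space f P) : ∃ (k : ℕ) (x : E) (s : ℝ), x ∈ P ∧ s ∈ Ico (0 : ℝ) 1 ∧
      p = emb f k x s := by
  obtain ⟨k, ⟨x, s⟩, ⟨hx, hs⟩, rfl⟩ := mem_iUnion.1 hp
  dsimp only at hx hs ⊢
  rcases hs.2.lt_or_eq with h1 | h1
  · exact ⟨k, x, s, hx, ⟨hs.1, h1⟩, rfl⟩
  · refine ⟨k + 1, f x, 0, hfP hx, ⟨le_rfl, one_pos⟩, ?_⟩
    rw [h1, emb_one]

/-- The pieces are compact when `P` is compact and `f` is continuous on `P`. [folklore] -/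
theorem isCompact_piece {f : E → E} {P : Set E} (hP : IsCompact P) (hf : ContinuousOn f P)
    (k : ℕ) : IsCompact (piece f P k) :=
  (hP.prod isCompact_Icc).image_of_continuousOn
    ((continuousOn_emb hf k).mono (prod_mono subset_rfl (subset_univ _)))

/-- The pieces are closed (`E × E × ℝ` is Hausdorff). [folklore] -/
theorem isClosed_piece {f : E → E} {P : Set E} (hP : IsCompact P) (hf : ContinuousOn f P)
    (k : ℕ) : IsClosed (piece f P k) :=
  (isCompact_piece hP hf k).isClosed

/-- **The pieces form a locally finite family** (the `k`-th piece lives at heights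
`[k, k + 1]`). [folklore] -/
theorem locallyFinite_piece (f : E → E) (P : Set E) : LocallyFinite (piece f P) := by
  intro p
  refine ⟨{q | q.2.2 ∈ Ioo (p.2.2 - 1) (p.2.2 + 1)}, ?_, ?_⟩
  · refine (isOpen_Ioo.preimage (continuous_snd.comp continuous_snd)).mem_nhds ?_
    show p.2.2 ∈ Ioo (p.2.2 - 1) (p.2.2 + 1)
    exact ⟨by linarith, by linarith⟩
  · -- only the levels `k` with `[k, k + 1] ∩ (c - 1, c + 1) ≠ ∅` occur: `k < c + 1`, `c - 2 < k`
    refine (finite_Iio (⌊p.2.2⌋₊ + 2)).subset ?_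
    rintro k ⟨q, hq, hq'⟩
    have h1 := height_mem_of_mem_piece hq
    have hq1 : p.2.2 - 1 < q.2.2 := hq'.1
    have hq2 : q.2.2 < p.2.2 + 1 := hq'.2
    have h3 : p.2.2 < ⌊p.2.2⌋₊ + 1 := Nat.lt_floor_add_one _
    show k < ⌊p.2.2⌋₊ + 2
    have h4 : (k : ℝ) < ⌊p.2.2⌋₊ + 2 := by linarith [h1.1]
    exact_mod_cast h4

/-- The telescope is closed when `P` is compact and `f` is continuous on `P`. [folklore] -/
theorem isClosed_space {f : E → E} {P : Set E} (hP : IsCompact P) (hf : ContinuousOn f P) :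
    IsClosed (space f P) :=
  (locallyFinite_piece f P).isClosed_iUnion (isClosed_piece hP hf)

/-! ### Maps out of the telescope -/

/-- **Continuity of maps out of the telescope** (the universal property of the quotient, for
compact `P`): a function on `E × E × ℝ` is continuous on the telescope as soon as, for every
level `k`, `(x, s) ↦ ψ (emb f k x s)` is continuous on `P × [0, 1]`. [folklore] -/
theorem continuousOn_of_comp_emb {Z : Type*} [TopologicalSpace Z] {f : E → E} {P : Set E}
    (hP : IsCompact P) (hf : ContinuousOn f P) {ψ : E × E × ℝ → Z}
    (h : ∀ k : ℕ, ContinuousOn (fun p : E × ℝ => ψ (emb f k p.1 p.2)) (P ×ˢ Icc 0 1)) :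
    ContinuousOn ψ (space f P) :=
  (locallyFinite_piece f P).continuousOn_iUnion (isClosed_piece hP hf) fun k =>
    continuousOn_image_of_comp (hP.prod isCompact_Icc)
      ((continuousOn_emb hf k).mono (prod_mono subset_rfl (subset_univ _))) (h k)

/-- The level of a telescope point: the integer part of its height. [folklore] -/
def lev (p : E × E × ℝ) : ℕ := ⌊p.2.2⌋₊

/-- The height parameter of a telescope point within its level, in `[0, 1)`. [folklore] -/
def par (p : E × E × ℝ) : ℝ := p.2.2 - ⌊p.2.2⌋₊

/-- The base point of a telescope point (canonical representative). [folklore] -/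
def pt (p : E × E × ℝ) : E := if par p = 0 then p.1 else (par p * (1 - par p))⁻¹ • p.2.1

/-- The level of a canonical representative. [folklore] -/
theorem lev_emb (f : E → E) (k : ℕ) (x : E) {s : ℝ} (hs : s ∈ Ico (0 : ℝ) 1) :
    lev (emb f k x s) = k := by
  simp only [lev, emb_height]
  rw [Nat.floor_eq_iff (add_nonneg (Nat.cast_nonneg k) hs.1)]
  constructor <;> linarith [hs.1, hs.2]

/-- The height parameter of a canonical representative. [folklore] -/
theorem par_emb (f : E → E) (k : ℕ) (x : E) {s : ℝ} (hs : s ∈ Ico (0 : ℝ) 1) :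
    par (emb f k x s) = s := by
  have h := lev_emb f k x hs
  simp only [lev, emb_height] at h
  simp only [par, emb_height, h]
  ring

/-- The base point of a canonical representative. [folklore] -/
theorem pt_emb (f : E → E) (k : ℕ) (x : E) {s : ℝ} (hs : s ∈ Ico (0 : ℝ) 1) :
    pt (emb f k x s) = x := by
  simp only [pt, par_emb f k x hs]
  split_ifs with h0
  · subst h0; simp [emb]
  · have hne : s * (1 - s) ≠ 0 := mul_ne_zero h0 (by linarith [hs.2])
    simp only [emb]
    rw [smul_smul, inv_mul_cancel₀ hne, one_smul]

/-- **Functions on the telescope from levelwise data**: `lift F` is the function on `E × E × ℝ`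
whose value at the telescope point `emb f k x s` (`s ∈ [0, 1)`) is `F k x s`. [folklore] -/
def lift {Z : Type*} (F : ℕ → E → ℝ → Z) (p : E × E × ℝ) : Z := F (lev p) (pt p) (par p)

/-- `lift F` at canonical representatives. [folklore] -/
theorem lift_emb_of_lt {Z : Type*} (F : ℕ → E → ℝ → Z) (f : E → E) (k : ℕ) (x : E) {s : ℝ}
    (hs : s ∈ Ico (0 : ℝ) 1) : lift F (emb f k x s) = F k x s := by
  simp only [lift, lev_emb f k x hs, pt_emb f k x hs, par_emb f k x hs]

/-- **`lift F` on all of `P × [0, 1]`**, given the compatibility of the levelwise data with the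
telescope identification: `F k x 1 = F (k + 1) (f x) 0` for `x ∈ P`. [folklore] -/
theorem lift_emb {Z : Type*} {F : ℕ → E → ℝ → Z} {f : E → E} {P : Set E}
    (hF : ∀ k, ∀ x ∈ P, F k x 1 = F (k + 1) (f x) 0) (k : ℕ) {x : E} (hx : x ∈ P) {s : ℝ}
    (hs : s ∈ Icc (0 : ℝ) 1) : lift F (emb f k x s) = F k x s := by
  rcases hs.2.lt_or_eq with h1 | h1
  · exact lift_emb_of_lt F f k x ⟨hs.1, h1⟩
  · subst h1
    rw [emb_one, lift_emb_of_lt F f (k + 1) (f x) ⟨le_rfl, one_pos⟩, hF k x hx]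

/-- **Continuity of `lift F` on the telescope** from continuity of each `F k` on `P × [0, 1]`
and the compatibility condition. [folklore] -/
theorem continuousOn_lift {Z : Type*} [TopologicalSpace Z] {F : ℕ → E → ℝ → Z} {f : E → E}
    {P : Set E} (hP : IsCompact P) (hf : ContinuousOn f P)
    (hF : ∀ k, ∀ x ∈ P, F k x 1 = F (k + 1) (f x) 0)
    (hc : ∀ k, ContinuousOn (fun p : E × ℝ => F k p.1 p.2) (P ×ˢ Icc 0 1)) :
    ContinuousOn (lift F) (space f P) :=
  continuousOn_of_comp_emb hP hf fun k => (hc k).congr fun _ hp => lift_emb hF k hp.1 hp.2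

/-- **Continuity of homotopies out of the telescope**: a function on `(E × E × ℝ) × T`, `T` a
compact space (e.g. `[0, 1]`), is continuous on `telescope × T` as soon as its pullbacks
`((x, s), t) ↦ ψ (emb f k x s, t)` are continuous on `(P × [0, 1]) × T` (`T` Hausdorff).
[folklore] -/
theorem continuousOn_prod_of_comp_emb {Z T : Type*} [TopologicalSpace Z] [TopologicalSpace T]
    [CompactSpace T] [T2Space T] {f : E → E} {P : Set E} (hP : IsCompact P)
    (hf : ContinuousOn f P)
    {ψ : (E × E × ℝ) × T → Z}
    (h : ∀ k : ℕ, ContinuousOn (fun q : (E × ℝ) × T => ψ (emb f k q.1.1 q.1.2, q.2))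
      ((P ×ˢ Icc 0 1) ×ˢ univ)) :
    ContinuousOn ψ (space f P ×ˢ univ) := by
  have hlf : LocallyFinite fun k => piece f P k ×ˢ (univ : Set T) :=
    (locallyFinite_piece f P).prod_right fun _ => univ
  have hU : space f P ×ˢ (univ : Set T) = ⋃ k, piece f P k ×ˢ (univ : Set T) := by
    simp only [space, iUnion_prod_const]
  rw [hU]
  refine hlf.continuousOn_iUnion (fun k => (isClosed_piece hP hf k).prod isClosed_univ) fun k => ?_
  have himg : piece f P k ×ˢ (univ : Set T) =
      (Prod.map (fun p : E × ℝ => emb f k p.1 p.2) id) '' ((P ×ˢ Icc 0 1) ×ˢ univ) := by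
    rw [prodMap_image_prod, image_id]
    rfl
  rw [himg]
  refine continuousOn_image_of_comp ((hP.prod isCompact_Icc).prod isCompact_univ) ?_ (h k)
  exact ((continuousOn_emb hf k).mono (prod_mono subset_rfl (subset_univ _))).prodMap
    continuousOn_id

end Telescope

end Literature.AlgebraicTopology.Homotopy

end
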